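import Summits.BirchSwinnertonDyer.Rank1Residual.Supersingular.KobayashiConverseReal
import Summits.BirchSwinnertonDyer.Rank1Residual.Supersingular.KobayashiMainConjectureX7
import HarnessLib

/-!
# At a rank-zero X6 / X7 pair, `BSD(E,p)` ⟺ Kobayashi's signed main conjecture ⟺ its Eisenstein half,
# for EITHER sign — granted published theorems only (cell `b2b-bsdres`, supersingular family, prover A =
# unit `b2b-bsdres-x10b`, gen 6; the ± side; X7 joint with prover B = `b2b-bsdres-additive-p3`)

HONEST FRAMING (run/shared/lean/b2b/bsd-rank1-residual/, verbatim in every file): the goal of the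
cell is to DELETE the COMBINATION-SHAPED residual classes of the Birch–Swinnerton-Dyer formula for
ALL analytic-rank `≤ 1` elliptic curves over `ℚ` — "full BSD formula for every rank `≤ 1` curve in
class `C`" assembled STRICTLY from published theorems — so that the rank-`≤ 1` remainder becomes
exactly the CONSTRUCTION-SHAPED classes, which are TYPED (missing-input `Prop`s), NOT attempted.
This is not "finishing BSD". THEOREMS ONLY (equivalences between the cell's own typed predicates,
granted PUBLISHED named facts displayed as hypotheses); per pair; NOT a class theorem; X6 and X7 stay
CONSTRUCTION-SHAPED; nothing is booked here.

## What this file says (X6-ROUTE.md §5–§6; the ± side at rank zero, closing the loop)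

Gen 4 of this seat typed Kobayashi's main conjecture for `(E, p, ε)` on the REAL tree objects
(`KobayashiMainConjecture W p ε`, `KobayashiMainConjecture.lean` p209365) and proved the forward
direction `X6.bsdp_of_kobayashiLowerDivisibility_of_analyticRank_eq_zero`: on X6 ∩ {`r_an = 0`}, odd `p`,
the Eisenstein half `KobayashiLowerDivisibility W p ε` for ONE sign gives `BSD(E,p)` (Wuthrich Prop. 21 +
Kobayashi Thm. 1.2 + B. D. Kim Cor. 3.15 + Pollack + modularity + GZK, all PUBLISHED, by name). Prover B
(gen 3, `KobayashiConverseReal.lean` p213380) proved the converse on the real objects: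
`X6.kobayashiMainConjecture_of_bsdp_of_analyticRank_eq_zero` — `BSD(E,p)` settled at a rank-zero pair gives
the FULL main conjecture for BOTH signs (Kobayashi Thm. 4.1 = the Kato-side divisibility, Thm. 1.2, Kim
Cor. 3.15, the period-unit facts, Wuthrich Lemma 20, GZK). This file merely closes the loop, so that the
cell's statement of the X6 rank-zero residue is an EQUIVALENCE and visibly sign-independent:

* `X6.bsdp_iff_kobayashiMainConjecture_of_analyticRank_eq_zero` — X6 ∧ `r_an = 0` ∧ `p` odd: for each
  sign `ε`, `BSDp W p ↔ KobayashiMainConjecture W p ε`.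
* `X6.bsdp_iff_kobayashiLowerDivisibility_of_analyticRank_eq_zero` — likewise `↔ KobayashiLowerDivisibility W p ε`.
* `X6.kobayashiLowerDivisibility_iff_mainConjecture_of_analyticRank_eq_zero` — at such a pair the
  Eisenstein half for `ε` is EQUIVALENT to the whole conjecture for `ε` (the other half being Kobayashi
  Thm. 4.1, published);
* `X6.kobayashiMainConjecture_iff_of_analyticRank_eq_zero` — and the conjecture for `ε` is EQUIVALENT to
  the conjecture for `ε'`: at a rank-zero X6 pair the two signed main conjectures stand or fall together.
* X7 twins (`a_p = 0` and surj(p) displayed, as in the X7 forward/converse theorems):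
  `X7.bsdp_iff_kobayashiMainConjecture_of_surj_of_analyticRank_eq_zero`,
  `X7.kobayashiMainConjecture_iff_of_surj_of_analyticRank_eq_zero`.

Reading: the rank-zero X6 residue "`KobayashiLowerDivisibility` for one sign" (typed, OPEN; announced by
BSTW arXiv:2409.01350 Thm. 1.3, PRE) is not merely sufficient but EXACTLY the missing input, granted the
published facts listed in the hypotheses; every per-pair closure of the census (Wuthrich-L1, visibility,
Kurihara numbers, 3-descent + Cassels–Tate) is therefore also a kernel instance of Kobayashi's conjecture
for both signs at that pair (B's converse), and conversely nothing weaker than the conjecture at the pair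
can close it through this route. Rank one is NOT touched (the link there is Kobayashi 2013's `p`-adic
Gross–Zagier formula, flag KOB13, source not held).

References: Kobayashi 2003 [Kobayashi2003] Thm. 1.2, Thm. 4.1, (3.6), Conjecture p. 2; B. D. Kim 2013
[BDKim2013] Cor. 3.15; Pollack 2003 [Pollack2003]; Wuthrich 2014 [Wuthrich2014] Prop. 21, Lemma 20;
Greenberg–Vatsal 2000 Rem. 3.4 [GreenbergVatsal2000]; Serre 1972 Props. 12, 21 [Serre1972]; Miller 2011
Def. 1.1 [Miller2011LMS]; BSTW arXiv:2409.01350 (announced, PRE) [BurungaleSkinnerTianWan2024].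
-/

set_option autoImplicit false

noncomputable section

open scoped Classical MatrixGroups ModularForm

open CongruenceSubgroup WeierstrassCurve Literature.NumberTheory.EllipticCurves
  Literature.NumberTheory.EllipticCurves.ModularForms
  Literature.NumberTheory.EllipticCurves.Rank1Residual
  Literature.NumberTheory.EllipticCurves.Rank1Residual.Typed

namespace Summit.BirchSwinnertonDyer.Rank1Residual.Supersingular

variable (W : WeierstrassCurve ℚ) [W.IsElliptic] [W.IsGloballyMinimal] (p : ℕ) [Fact p.Prime]

/-! ### Class X6 (good supersingular, semistable, `p ≥ 5 ∨ a_3 = 0`), analytic rank `0`, odd `p` -/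

/-- **X6 ∧ `r_an = 0` ∧ `p` odd: `BSD(E,p)` ⟺ Kobayashi's main conjecture for `(E, p, ε)`, for each sign
`ε`**, granted the PUBLISHED named facts displayed: Wuthrich Prop. 21 (`hW`), Kobayashi Thm. 1.2 (`h12`)
and Thm. 4.1 (`h41`), B. D. Kim Cor. 3.15 (`hKim`), Pollack's `L_p^±` (`hPollack`), modularity (`hmod`,
`hmod'`), GZK (`hGZK`), the period-unit facts (`h5`, `h3`), Wuthrich Lemma 20 (`hL20`). Forward = this
seat's gen-4 theorem through the Eisenstein half; backward = prover B's rank-zero converse. Per pair;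
NOT a class theorem. [cite: Kobayashi2003, Thm. 1.2, Thm. 4.1, (3.6) and Conjecture (p. 2)]
[cite: BDKim2013, Cor. 3.15 (p. 199)] [cite: Wuthrich2014, Prop. 21 (p. 400) and Lemma 20 (p. 399)]
[cite: Miller2011LMS, Def. 1.1] -/
theorem X6.bsdp_iff_kobayashiMainConjecture_of_analyticRank_eq_zero
    (hW : Wuthrich2014.sha_dvd_analyticSha)
    (h12 : Kobayashi2003.thm12_signedSelmerDual_finite_torsion)
    (h41 : Kobayashi2003.thm41_signedCharIdeal_divisibility)
    (hKim : BDKim2013.cor315_signedCharValue_rankZero)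
    (hPollack : ∀ {N : ℕ} [NeZero N] {f : CuspForm (Gamma0 N) 2},
      pollack_exists_plusMinusPAdicLFunction (W := W) (f := f) (p := p))
    (hmod : nonempty_modularParametrizationData) (hmod' : hasEntireLFunction_rat)
    (hGZK : rank_eq_analyticRank_of_analyticRank_le_one)
    (h5 : realPeriodRat_eq_unit_mul_plusPeriod) (h3 : realPeriodRat_eq_unit_mul_plusPeriod_three)
    (hL20 : Wuthrich2014.lemma20_surjective_threeAdic_of_semistable)
    (hp : p ≠ 2) (hX : ClassX6 W p) (h0 : W.analyticRank = 0) (ε : ℤˣ) :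
    BSDp W p ↔ KobayashiMainConjecture W p ε :=
  ⟨fun hB ↦ X6.kobayashiMainConjecture_of_bsdp_of_analyticRank_eq_zero W p h12 h41 hKim h5 h3 hL20 hGZK
      hmod' hp hX h0 hB ε,
    fun hMC ↦ X6.bsdp_of_kobayashiMainConjecture_of_analyticRank_eq_zero W p hW h12 hKim hPollack hmod hmod'
      hGZK hp hX h0 hMC⟩

/-- **X6 ∧ `r_an = 0` ∧ `p` odd: `BSD(E,p)` ⟺ the Eisenstein half `KobayashiLowerDivisibility W p ε`
(the cell's typed rank-zero X6 residue) for each sign `ε`** — same named facts. Per pair.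
[cite: Kobayashi2003, Thm. 1.2, Thm. 4.1 and Conjecture (p. 2)] [cite: BDKim2013, Cor. 3.15 (p. 199)]
[cite: Wuthrich2014, Prop. 21 (p. 400)] [cite: Miller2011LMS, Def. 1.1] -/
theorem X6.bsdp_iff_kobayashiLowerDivisibility_of_analyticRank_eq_zero
    (hW : Wuthrich2014.sha_dvd_analyticSha)
    (h12 : Kobayashi2003.thm12_signedSelmerDual_finite_torsion)
    (h41 : Kobayashi2003.thm41_signedCharIdeal_divisibility)
    (hKim : BDKim2013.cor315_signedCharValue_rankZero)
    (hPollack : ∀ {N : ℕ} [NeZero N] {f : CuspForm (Gamma0 N) 2},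
      pollack_exists_plusMinusPAdicLFunction (W := W) (f := f) (p := p))
    (hmod : nonempty_modularParametrizationData) (hmod' : hasEntireLFunction_rat)
    (hGZK : rank_eq_analyticRank_of_analyticRank_le_one)
    (h5 : realPeriodRat_eq_unit_mul_plusPeriod) (h3 : realPeriodRat_eq_unit_mul_plusPeriod_three)
    (hL20 : Wuthrich2014.lemma20_surjective_threeAdic_of_semistable)
    (hp : p ≠ 2) (hX : ClassX6 W p) (h0 : W.analyticRank = 0) (ε : ℤˣ) :
    BSDp W p ↔ KobayashiLowerDivisibility W p ε :=
  ⟨fun hB ↦ kobayashiLowerDivisibility_of_mainConjecture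
      (X6.kobayashiMainConjecture_of_bsdp_of_analyticRank_eq_zero W p h12 h41 hKim h5 h3 hL20 hGZK hmod' hp
        hX h0 hB ε),
    fun hdiv ↦ X6.bsdp_of_kobayashiLowerDivisibility_of_analyticRank_eq_zero W p hW h12 hKim hPollack hmod
      hmod' hGZK hp hX h0 hdiv⟩

/-- **At a rank-zero X6 pair the Eisenstein half is equivalent to the whole main conjecture** (for the
same sign `ε`): `KobayashiLowerDivisibility W p ε ↔ KobayashiMainConjecture W p ε`, granted the published
facts (the Kato-side half being Kobayashi Thm. 4.1, `h41`). Per pair.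
[cite: Kobayashi2003, Thm. 4.1 (p. 8) and Conjecture (p. 2)] [cite: Wuthrich2014, Prop. 21 (p. 400)] -/
theorem X6.kobayashiLowerDivisibility_iff_mainConjecture_of_analyticRank_eq_zero
    (hW : Wuthrich2014.sha_dvd_analyticSha)
    (h12 : Kobayashi2003.thm12_signedSelmerDual_finite_torsion)
    (h41 : Kobayashi2003.thm41_signedCharIdeal_divisibility)
    (hKim : BDKim2013.cor315_signedCharValue_rankZero)
    (hPollack : ∀ {N : ℕ} [NeZero N] {f : CuspForm (Gamma0 N) 2},
      pollack_exists_plusMinusPAdicLFunction (W := W) (f := f) (p := p))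
    (hmod : nonempty_modularParametrizationData) (hmod' : hasEntireLFunction_rat)
    (hGZK : rank_eq_analyticRank_of_analyticRank_le_one)
    (h5 : realPeriodRat_eq_unit_mul_plusPeriod) (h3 : realPeriodRat_eq_unit_mul_plusPeriod_three)
    (hL20 : Wuthrich2014.lemma20_surjective_threeAdic_of_semistable)
    (hp : p ≠ 2) (hX : ClassX6 W p) (h0 : W.analyticRank = 0) (ε : ℤˣ) :
    KobayashiLowerDivisibility W p ε ↔ KobayashiMainConjecture W p ε := by
  rw [← X6.bsdp_iff_kobayashiLowerDivisibility_of_analyticRank_eq_zero W p hW h12 h41 hKim hPollack hmod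
      hmod' hGZK h5 h3 hL20 hp hX h0 ε,
    X6.bsdp_iff_kobayashiMainConjecture_of_analyticRank_eq_zero W p hW h12 h41 hKim hPollack hmod hmod'
      hGZK h5 h3 hL20 hp hX h0 ε]

/-- **Sign independence at a rank-zero X6 pair**: `KobayashiMainConjecture W p ε ↔ KobayashiMainConjecture W p ε'`
for any two signs, granted the published facts — the `+` and `−` main conjectures stand or fall together
there (both being equivalent to `BSD(E,p)`). Per pair. [cite: Kobayashi2003, Conjecture (p. 2), Thm. 1.2, Thm. 4.1]
[cite: Wuthrich2014, Prop. 21 (p. 400)] -/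
theorem X6.kobayashiMainConjecture_iff_of_analyticRank_eq_zero
    (hW : Wuthrich2014.sha_dvd_analyticSha)
    (h12 : Kobayashi2003.thm12_signedSelmerDual_finite_torsion)
    (h41 : Kobayashi2003.thm41_signedCharIdeal_divisibility)
    (hKim : BDKim2013.cor315_signedCharValue_rankZero)
    (hPollack : ∀ {N : ℕ} [NeZero N] {f : CuspForm (Gamma0 N) 2},
      pollack_exists_plusMinusPAdicLFunction (W := W) (f := f) (p := p))
    (hmod : nonempty_modularParametrizationData) (hmod' : hasEntireLFunction_rat)
    (hGZK : rank_eq_analyticRank_of_analyticRank_le_one)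
    (h5 : realPeriodRat_eq_unit_mul_plusPeriod) (h3 : realPeriodRat_eq_unit_mul_plusPeriod_three)
    (hL20 : Wuthrich2014.lemma20_surjective_threeAdic_of_semistable)
    (hp : p ≠ 2) (hX : ClassX6 W p) (h0 : W.analyticRank = 0) (ε ε' : ℤˣ) :
    KobayashiMainConjecture W p ε ↔ KobayashiMainConjecture W p ε' := by
  rw [← X6.bsdp_iff_kobayashiMainConjecture_of_analyticRank_eq_zero W p hW h12 h41 hKim hPollack hmod hmod'
      hGZK h5 h3 hL20 hp hX h0 ε,
    X6.bsdp_iff_kobayashiMainConjecture_of_analyticRank_eq_zero W p hW h12 h41 hKim hPollack hmod hmod'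
      hGZK h5 h3 hL20 hp hX h0 ε']

/-! ### Class X7 (good supersingular, `E` not semistable), analytic rank `0`, odd `p`, `a_p = 0`, surj(p) -/

/-- **X7 ∧ `r_an = 0` ∧ `p` odd ∧ `a_p = 0` ∧ surj(p): `BSD(E,p)` ⟺ Kobayashi's main conjecture for
`(E, p, ε)`, for each sign** (`a_p = 0` is automatic for `p ≥ 5`, `ClassX7.frobeniusTrace_eq_zero_of_five_le`;
surjectivity is a per-pair datum on X7). Same published facts as the X6 statement. Per pair; NOT a class
theorem. [cite: Kobayashi2003, Thm. 1.2, Thm. 4.1 and Conjecture (p. 2)] [cite: BDKim2013, Cor. 3.15 (p. 199)]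
[cite: Wuthrich2014, Prop. 21 (p. 400) and Lemma 20 (p. 399)] [cite: Miller2011LMS, Def. 1.1] -/
theorem X7.bsdp_iff_kobayashiMainConjecture_of_surj_of_analyticRank_eq_zero
    (hW : Wuthrich2014.sha_dvd_analyticSha)
    (h12 : Kobayashi2003.thm12_signedSelmerDual_finite_torsion)
    (h41 : Kobayashi2003.thm41_signedCharIdeal_divisibility)
    (hKim : BDKim2013.cor315_signedCharValue_rankZero)
    (hPollack : ∀ {N : ℕ} [NeZero N] {f : CuspForm (Gamma0 N) 2},
      pollack_exists_plusMinusPAdicLFunction (W := W) (f := f) (p := p))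
    (hmod : nonempty_modularParametrizationData) (hmod' : hasEntireLFunction_rat)
    (hGZK : rank_eq_analyticRank_of_analyticRank_le_one)
    (h5 : realPeriodRat_eq_unit_mul_plusPeriod) (h3 : realPeriodRat_eq_unit_mul_plusPeriod_three)
    (hL20 : Wuthrich2014.lemma20_surjective_threeAdic_of_semistable)
    (hp : p ≠ 2) (hX : ClassX7 W p) (hap : W.frobeniusTrace p = 0) (hs : Surj W p)
    (h0 : W.analyticRank = 0) (ε : ℤˣ) :
    BSDp W p ↔ KobayashiMainConjecture W p ε :=
  ⟨fun hB ↦ X7.kobayashiMainConjecture_of_bsdp_of_analyticRank_eq_zero W p h12 h41 hKim h5 h3 hL20 hGZK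
      hmod' hp hX hap hs h0 hB ε,
    fun hMC ↦ X7.bsdp_of_kobayashiLowerDivisibility_of_surj_of_analyticRank_eq_zero W p hW h12 hKim hPollack
      hmod hmod' hGZK hp hX hap hs h0 (kobayashiLowerDivisibility_of_mainConjecture hMC)⟩

/-- **X7 ∧ `r_an = 0` ∧ `p` odd ∧ `a_p = 0` ∧ surj(p): `BSD(E,p)` ⟺ the Eisenstein half
`KobayashiLowerDivisibility W p ε`, for each sign** — the cell's typed rank-zero X7 residue (surjective
branch) is exactly the missing input. Per pair. [cite: Kobayashi2003, Thm. 1.2, Thm. 4.1 and Conjecture (p. 2)]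
[cite: BDKim2013, Cor. 3.15 (p. 199)] [cite: Wuthrich2014, Prop. 21 (p. 400)] [cite: Miller2011LMS, Def. 1.1] -/
theorem X7.bsdp_iff_kobayashiLowerDivisibility_of_surj_of_analyticRank_eq_zero
    (hW : Wuthrich2014.sha_dvd_analyticSha)
    (h12 : Kobayashi2003.thm12_signedSelmerDual_finite_torsion)
    (h41 : Kobayashi2003.thm41_signedCharIdeal_divisibility)
    (hKim : BDKim2013.cor315_signedCharValue_rankZero)
    (hPollack : ∀ {N : ℕ} [NeZero N] {f : CuspForm (Gamma0 N) 2},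
      pollack_exists_plusMinusPAdicLFunction (W := W) (f := f) (p := p))
    (hmod : nonempty_modularParametrizationData) (hmod' : hasEntireLFunction_rat)
    (hGZK : rank_eq_analyticRank_of_analyticRank_le_one)
    (h5 : realPeriodRat_eq_unit_mul_plusPeriod) (h3 : realPeriodRat_eq_unit_mul_plusPeriod_three)
    (hL20 : Wuthrich2014.lemma20_surjective_threeAdic_of_semistable)
    (hp : p ≠ 2) (hX : ClassX7 W p) (hap : W.frobeniusTrace p = 0) (hs : Surj W p)
    (h0 : W.analyticRank = 0) (ε : ℤˣ) :
    BSDp W p ↔ KobayashiLowerDivisibility W p ε :=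
  ⟨fun hB ↦ kobayashiLowerDivisibility_of_mainConjecture
      (X7.kobayashiMainConjecture_of_bsdp_of_analyticRank_eq_zero W p h12 h41 hKim h5 h3 hL20 hGZK hmod' hp
        hX hap hs h0 hB ε),
    fun hdiv ↦ X7.bsdp_of_kobayashiLowerDivisibility_of_surj_of_analyticRank_eq_zero W p hW h12 hKim
      hPollack hmod hmod' hGZK hp hX hap hs h0 hdiv⟩

/-- **Sign independence at a rank-zero X7 pair** (`a_p = 0`, surj(p)):
`KobayashiMainConjecture W p ε ↔ KobayashiMainConjecture W p ε'`. Per pair.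
[cite: Kobayashi2003, Conjecture (p. 2), Thm. 1.2, Thm. 4.1] [cite: Wuthrich2014, Prop. 21 (p. 400)] -/
theorem X7.kobayashiMainConjecture_iff_of_surj_of_analyticRank_eq_zero
    (hW : Wuthrich2014.sha_dvd_analyticSha)
    (h12 : Kobayashi2003.thm12_signedSelmerDual_finite_torsion)
    (h41 : Kobayashi2003.thm41_signedCharIdeal_divisibility)
    (hKim : BDKim2013.cor315_signedCharValue_rankZero)
    (hPollack : ∀ {N : ℕ} [NeZero N] {f : CuspForm (Gamma0 N) 2},
      pollack_exists_plusMinusPAdicLFunction (W := W) (f := f) (p := p))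
    (hmod : nonempty_modularParametrizationData) (hmod' : hasEntireLFunction_rat)
    (hGZK : rank_eq_analyticRank_of_analyticRank_le_one)
    (h5 : realPeriodRat_eq_unit_mul_plusPeriod) (h3 : realPeriodRat_eq_unit_mul_plusPeriod_three)
    (hL20 : Wuthrich2014.lemma20_surjective_threeAdic_of_semistable)
    (hp : p ≠ 2) (hX : ClassX7 W p) (hap : W.frobeniusTrace p = 0) (hs : Surj W p)
    (h0 : W.analyticRank = 0) (ε ε' : ℤˣ) :
    KobayashiMainConjecture W p ε ↔ KobayashiMainConjecture W p ε' := by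
  rw [← X7.bsdp_iff_kobayashiMainConjecture_of_surj_of_analyticRank_eq_zero W p hW h12 h41 hKim hPollack
      hmod hmod' hGZK h5 h3 hL20 hp hX hap hs h0 ε,
    X7.bsdp_iff_kobayashiMainConjecture_of_surj_of_analyticRank_eq_zero W p hW h12 h41 hKim hPollack hmod
      hmod' hGZK h5 h3 hL20 hp hX hap hs h0 ε']

end Summit.BirchSwinnertonDyer.Rank1Residual.Supersingular

end
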